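import Summits.CriticalPhenomena.PercolationContinuityZ3.Theses.PercNonProliferation
import Literature.Probability.Percolation.SusceptibilityGammaOne
import Literature.Probability.Percolation.UniquenessZone

/-!
# Sketch — crux-ideate `stmt-CriticalPhenomena-4445` (FreeBoxSparse), round 1, ideator 2 (gen 2)

First-lemma signatures (Props only, nothing proved) for the crux idea card
`ccfs-offcritical-transfer` ("the √N window moves FreeBoxSparse off p_c").
Constants: tree decls `box`, `zdGraph`, `Site`, `bondPercolation`, `criticalProbI`, `criticalProb`,
`openConnIn`, `openCluster`, `chi` (`Literature.Probability.Percolation.chi d p = Σ' x τ_p(0,x)`,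
`SusceptibilityGammaOne.lean`), and the route decl `PercNonProliferation.FreeBoxSparse` (fixed).
-/

noncomputable section

open MeasureTheory Filter
open scoped Classical Topology
open Literature.Probability.Percolation Literature.Probability.LatticeModels

namespace Summit.CriticalPhenomena.PercolationContinuityZ3.Cruxes.FreeBoxSparse.Ideator2g2

/-- `P_p` on `ℤ³`. -/
abbrev μ (p : unitInterval) : Measure (BondConfig (Site 3)) := bondPercolation (zdGraph 3) p

/-- The free-box pair average `FA₂(p, n) = |Λ_n|⁻² Σ_{x,y ∈ Λ_n} P_p(x ↔ y inside Λ_n)` at a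
general parameter (the crux is `FA₂(p_c, ·) → 0`, `freeBoxSparse_iff` below, `Iff.rfl`). -/
def FA2 (p : unitInterval) (n : ℕ) : ℝ :=
  (∑ x ∈ box 3 n, ∑ y ∈ box 3 n, (μ p).real (openConnIn (↑(box 3 n) : Set (Site 3)) x y)) /
    ((box 3 n).card : ℝ) ^ 2

theorem freeBoxSparse_iff :
    Summit.CriticalPhenomena.PercolationContinuityZ3.Theses.PercNonProliferation.FreeBoxSparse ↔
      Tendsto (FA2 (criticalProbI 3)) atTop (𝓝 0) := Iff.rfl

/-- The parameter `p_c + t`, clamped into `[0,1]`. -/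
def shiftedParam (t : ℝ) : unitInterval :=
  Set.projIcc (0 : ℝ) 1 zero_le_one ((criticalProbI 3 : ℝ) + t)

/-- The CCFS/Bessel half-width of the statistical-indistinguishability window at box scale `n`:
`w(n) = (2n+1)^{-3/2} ≍ |E(Λ_n)|^{-1/2}`. -/
def ccfsWidth (n : ℕ) : ℝ := ((2 * n + 1 : ℕ) : ℝ) ^ (-(3 / 2 : ℝ))

/-! ### K1 — the window lemma (Russo–Margulis + Bessel at Fourier level 1; provable now) -/

/-- WINDOW LEMMA: `p ↦ FA₂(p, n)` is `C (2n+1)^{3/2}`-Lipschitz on any compact sub-interval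
`[a, b] ⊂ (0, 1)`: `d/dp FA₂ = Σ_e Cov_p(π_n, ω_e)/(p(1-p)) ≤ √(|E(Λ_n)| · Var π_n /(p(1-p)))`
with `π_n = Σ_K (|K|/|Λ_n|)² ∈ [0,1]`, `|E(Λ_n)| ≤ 3 (2n+1)³`. -/
def WindowLipschitz : Prop :=
  ∀ a b : ℝ, 0 < a → b < 1 → ∃ C : ℝ, ∀ n : ℕ, ∀ p q : unitInterval,
    a ≤ (p : ℝ) → (p : ℝ) ≤ b → a ≤ (q : ℝ) → (q : ℝ) ≤ b →
      |FA2 p n - FA2 q n| ≤ C * ((2 * n + 1 : ℕ) : ℝ) ^ (3 / 2 : ℝ) * |(p : ℝ) - q|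

/-- K0 — FBS IS DECIDED ANYWHERE IN THE WINDOW: for every real `c` (either sign),
`FreeBoxSparse ⟺ FA₂(p_c + c (2n+1)^{-3/2}, n) → 0`. (From `WindowLipschitz`: the two sequences
differ by at most `C |c|` for all large `n`, and `c` is arbitrary.) -/
def WindowTransfer : Prop :=
  ∀ c : ℝ,
    (Summit.CriticalPhenomena.PercolationContinuityZ3.Theses.PercNonProliferation.FreeBoxSparse ↔
      Tendsto (fun n : ℕ => FA2 (shiftedParam (c * ccfsWidth n)) n) atTop (𝓝 0))

/-! ### K2 — the subcritical majorant (provable now: `FA₂ = |Λ|⁻² Σ_v χ_n(p,v) ≤ χ(p)/|Λ|`,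
tree `chiBoxAt_le_chi`) -/

/-- `FA₂(p, n) ≤ χ(p)/|Λ_n|` for `p < p_c`. -/
def SubcriticalMajorant : Prop :=
  ∀ p : unitInterval, (p : ℝ) < criticalProb (zdGraph 3) (0 : Site 3) → ∀ n : ℕ,
    FA2 p n ≤ chi 3 p / ((box 3 n).card : ℝ)

/-! ### The transfer target C⁺ and its wiring -/

/-- C⁺ — SUSCEPTIBILITY SUB-QUADRATIC (`γ < 2` in the weakest form): `η² χ(p_c - η) → 0` as
`η ↓ 0`. Predicted `χ(p_c-η) ≍ η^{-γ}`, `γ = 1.80(1)` on `ℤ³` (true for `d ≥ 3`, FALSE for `d = 2`,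
`γ = 43/18`); rigorously only `γ ≥ 1` (Aizenman–Newman) is known. -/
def SusceptibilitySubquadratic : Prop :=
  Tendsto (fun η : ℝ => η ^ 2 * chi 3 (shiftedParam (-η))) (𝓝[>] 0) (𝓝 0)

/-- THE LINE: `C⁺ ⟹ crux` (K0 with `c = -1` + K2: `FA₂(p_c - w(n), n) ≤ χ(p_c - w(n)) w(n)² → 0`). -/
def freeBoxSparse_of_subquadratic : Prop :=
  SusceptibilitySubquadratic →
    Summit.CriticalPhenomena.PercolationContinuityZ3.Theses.PercNonProliferation.FreeBoxSparse

/-! ### By-products for the disprover (necessary conditions for `¬ FreeBoxSparse`) -/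

/-- `¬ FreeBoxSparse ⟹ γ ≥ 2` along a sequence: `χ(p_c - c w(n)) ≥ a (2n+1)³ = a c^{-2} w^{-2}`
infinitely often. -/
def gamma_ge_two_of_not_freeBoxSparse : Prop :=
  ¬ Summit.CriticalPhenomena.PercolationContinuityZ3.Theses.PercNonProliferation.FreeBoxSparse →
    ∃ a c : ℝ, 0 < a ∧ 0 < c ∧ ∃ᶠ n : ℕ in atTop,
      a * ((2 * n + 1 : ℕ) : ℝ) ^ (3 : ℕ) ≤ chi 3 (shiftedParam (-(c * ccfsWidth n)))

/-- `¬ FreeBoxSparse ⟹` SUBCRITICAL DROPLETS AT THE CCFS SCALE: at `p = p_c - c w(n) < p_c` the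
cluster of the origin has `≥ a |Λ_n|` vertices with probability `≥ a`, infinitely often
(translation average of the dense free piece; no infinite cluster is involved). -/
def subcriticalDroplets_of_not_freeBoxSparse : Prop :=
  ¬ Summit.CriticalPhenomena.PercolationContinuityZ3.Theses.PercNonProliferation.FreeBoxSparse →
    ∃ a c : ℝ, 0 < a ∧ 0 < c ∧ ∃ᶠ n : ℕ in atTop,
      a ≤ (μ (shiftedParam (-(c * ccfsWidth n)))).real
        {ω | ((⌈a * ((box 3 n).card : ℝ)⌉₊ : ℕ) : ℕ∞) ≤ (openCluster ω (0 : Site 3)).encard}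

/-- `¬ FreeBoxSparse ⟹` CCFS-EXTREMAL ONSET OF THE FREE-BOX GIANT above `p_c`: at
`p = p_c + c w(n)` the free `n`-box already carries pair-average `≥ a` infinitely often, i.e. the
free-giant onset length `L_free(p_c + η)` is `≤ (c/η)^{2/3}` along a sequence — the
Chayes–Chayes–Fisher–Spencer lower bound `ν ≥ 2/d` would be SATURATED by the free-box density. -/
def extremalOnset_of_not_freeBoxSparse : Prop :=
  ¬ Summit.CriticalPhenomena.PercolationContinuityZ3.Theses.PercNonProliferation.FreeBoxSparse →
    ∃ a : ℝ, 0 < a ∧ ∀ c : ℝ, 0 < c → ∃ᶠ n : ℕ in atTop, a ≤ FA2 (shiftedParam (c * ccfsWidth n)) n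


/-! ### Route-level pincer (for the tenure planner; NOT part of the crux line)

`H1(ε) ∧ H2(κ) ⇒ θ(p_c) = 0` when `κ < ε/(2−ε)`: in a jump world `τ ≥ θ*²`; `H2` makes the bulk pair
connectivity of `Λ_n` box-local in `Λ_N`, `N = ⌈n^{1+κ}⌉` (`avg_{x,y ∈ Λ_n} P_{p_c}(x ↔ y in Λ_N) ≥
θ*² − P(A₂(n,N))`); the window transports this [0,1]-functional of `Λ_N` to `p_c − c N^{-3/2}`, where the
majorant `χ(p)/|Λ_n|` applies: `χ(p_c − η) ≥ c η^{-2/(1+κ)}`, contradicting `H1(ε)`. Both hypotheses are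
statements about the REAL (sub)critical model in the hyperscaling regime `3 ≤ d ≤ 5`
(`d = 2`: `H1` false; `d > 6`: `H2` false). -/

/-- `H2(κ)` — POLYNOMIAL-ASPECT UNIQUENESS: two distinct clusters of the free box `Λ_N`,
`N = ⌈n^{1+κ}⌉`, both crossing from `Λ_n` to `∂Λ_N`, have vanishing probability (`A₂(n,N) =
(uniqZone n N)ᶜ`, tree `UniquenessZone.lean`; Cerf 2015 / DKT 2020 Prop. 1 = tree `dkt_prop1` proves it
at aspect `N = n^{1/α(d)}`, `α(3)` tiny; hyperscaling predicts it for every `κ > 0` in `d = 3`). -/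
def PolynomialAspectUniqueness (κ : ℝ) : Prop :=
  Tendsto (fun n : ℕ => (μ (criticalProbI 3)).real
    (uniqZone (d := 3) n ⌈((n : ℝ)) ^ (1 + κ)⌉₊)ᶜ) atTop (𝓝 0)

/-- `H1(ε)` — quantitative `γ ≤ 2 − ε`: `χ(p_c − η) ≤ C η^{-(2−ε)}` for small `η > 0`. -/
def SusceptibilityExponentBound (ε : ℝ) : Prop :=
  ∃ C η₀ : ℝ, 0 < η₀ ∧ ∀ η : ℝ, 0 < η → η < η₀ →
    chi 3 (shiftedParam (-η)) ≤ C * η ^ (-(2 - ε))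

/-- THE PINCER: `H1(ε) → H2(κ) → κ < ε/(2−ε) → θ(p_c(ℤ³)) = 0` (the sub-problem statement itself). -/
def WindowPincer : Prop :=
  ∀ ε κ : ℝ, 0 < ε → ε < 2 → 0 < κ → κ < ε / (2 - ε) →
    SusceptibilityExponentBound ε → PolynomialAspectUniqueness κ → _root_.PercolationContinuityZ3

end Summit.CriticalPhenomena.PercolationContinuityZ3.Cruxes.FreeBoxSparse.Ideator2g2

end
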